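import Mathlib
import Summits.BirchSwinnertonDyer.BirchSwinnertonDyer.Theorems.KatoDescentTamePotSupersingularTameLowerFibreAdjointBricksFiveSmallDrop

/-!
# Bricks for the `GL₂(𝔽₅)`-lifting route (T5′), XI: (T5′) at EVERY finite level of EVERY finite local
# ring with residue field `𝔽₅` (the Artinian kernel (P′) assembled; `f = 1`)

Continuation of files IX–X (`…AdjointBricksFiveSmallLayer`, `…SmallDrop`; same namespace). ARM-P audit r07 S7
ADD-1 §C (C0) states (T5′) for a closed `G ≤ GL₂(A)`, `A` complete local noetherian with residue field `⊇ 𝔽₅`,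
and proves it through (P′) one small surjection at a time plus (h) a limit. This file is the FINITE-LEVEL
statement for residue field exactly `𝔽₅` (every Δ1 ring `𝒪_𝔭` with `f = 1`, any ramification `e`, at every
level `𝒪_𝔭/𝔭ⁿ`), obtained by induction on the cardinality of the ring: a finite local ring `A` with residue
map `res : A → 𝔽₅` (units = `res ≠ 0`) is either `𝔽₅` or has a principal small ideal `tA ≅ 𝔽₅`
(`t ∈ 𝔪^{N-1} ∖ 0`, `𝔪^N = 0`); the quotient `A/tA` has the same characteristic `5^{m+1}` (file IX's layer)
unless `5^m 𝔪 = 0`, when one may take `t = 5^m` and the characteristic drops to `5^m` (file X's layer).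

* `exists_conj_smu_le_of_step` — the induction step in abstract form: from (T5′) for `B` (any `H_B`), a
  surjection `π : A → B` compatible with the residue maps along which units lift, and the layer statement for
  `π`, (T5′) for `A` follows (lift the conjugator, conjugate, apply the layer to `u₁⁻¹ H u₁ ∩ π⁻¹(S^μ)`).
* `exists_conj_smu_le_of_residual` — **(T5′) at every finite level, `f = 1`, `S^μ` currency: for a finite
  commutative ring `A` with a residue map `res : A → 𝔽₅` such that every `a` with `res a ≠ 0` is a unit
  (i.e. `A` local with residue field `𝔽₅`), of characteristic `5^{m+1}`, every subgroup `H ≤ GL₂(A)` with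
  `(det h)⁴ = 1` on `H` whose reduction `res(H)` is all of `GL₂(𝔽₅)` contains `u · S^μ(ℤ/5^{m+1}) · u⁻¹`
  for some `u ≡ 1 (mod 𝔪)`** — in particular a conjugate of `SL₂(ℤ/5^{m+1}) = SL₂(W(𝔽₅)_A)` (Kato's
  (12.5.2) / Skinner–Urban's lattice shape at finite level). The residual hypothesis `GL₂(𝔽₅)` (not
  `SL₂(𝔽₅)`) is essential: [M] Remark 4.4. The `det⁴ = 1` normalisation is removed in file XII.

What remains on paper for Δ1 proper after this file: residue fields `𝔽_{5^f}`, `f ≥ 2` (layers of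
`𝔽₅`-dimension `f`), and (h) the passage to the limit `𝒪_𝔭 = lim 𝒪_𝔭/𝔭ⁿ`. Route-free, no definitions,
nothing about elliptic curves or items 19618/19981 (open). Target T-S7r07-1 (`FibreLatticeInput 5`).
-/

set_option linter.dupNamespace false

open Matrix

namespace Summit.BirchSwinnertonDyer.BirchSwinnertonDyer.Theorems.GL2F5AdjointBricks

section localstep

variable {A B : Type*} [CommRing A] [CommRing B]

/-- **Induction step of (T5′), abstract form.** Let `π : A → B` be a surjection of rings of characteristics
`5^{m+1}` and `5^{k+1}`, compatible with residue maps `res`, `res_B` to `𝔽₅`, with every `a ∈ A` of non-zero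
residue a unit. Assume the LAYER statement for `π` (files IX/X: a subgroup `H₁ ≤ GL₂(A)` with `det⁴ = 1`
covering the image of `S^μ(ℤ/5^{k+1})` in `GL₂(B)` contains `u₂ S^μ(ℤ/5^{m+1}) u₂⁻¹`, `π(u₂) = 1`) and
(T5′) for `B`. Then (T5′) holds for `A`: every `H ≤ GL₂(A)` with `det⁴ = 1` and `res(H) = GL₂(𝔽₅)` contains
`u S^μ(ℤ/5^{m+1}) u⁻¹` with `res(u) = 1`. -/
theorem exists_conj_smu_le_of_step (m k : ℕ) [CharP A (5 ^ (m + 1))] [CharP B (5 ^ (k + 1))]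
    (π : A →+* B) (hπ : Function.Surjective π) (res : A →+* ZMod 5) (resB : B →+* ZMod 5)
    (hresB : resB.comp π = res) (hloc : ∀ a, res a ≠ 0 → IsUnit a)
    (hlayer : ∀ H₁ : Subgroup (GL (Fin 2) A),
      (∀ h ∈ H₁, Matrix.det (h : Matrix (Fin 2) (Fin 2) A) ^ 4 = 1) →
      (∀ q : GL (Fin 2) (ZMod (5 ^ (k + 1))),
        Matrix.det (q : Matrix (Fin 2) (Fin 2) (ZMod (5 ^ (k + 1)))) ^ 4 = 1 →
          ∃ h ∈ H₁, Matrix.GeneralLinearGroup.map π h =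
            Matrix.GeneralLinearGroup.map (ZMod.castHom (dvd_refl (5 ^ (k + 1))) B) q) →
        ∃ u₂ : GL (Fin 2) A, Matrix.GeneralLinearGroup.map π u₂ = 1 ∧
          ∀ g : GL (Fin 2) (ZMod (5 ^ (m + 1))),
            Matrix.det (g : Matrix (Fin 2) (Fin 2) (ZMod (5 ^ (m + 1)))) ^ 4 = 1 →
              u₂ * Matrix.GeneralLinearGroup.map (ZMod.castHom (dvd_refl (5 ^ (m + 1))) A) g * u₂⁻¹ ∈ H₁)
    (ihB : ∀ HB : Subgroup (GL (Fin 2) B),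
      (∀ h ∈ HB, Matrix.det (h : Matrix (Fin 2) (Fin 2) B) ^ 4 = 1) →
      (∀ q : GL (Fin 2) (ZMod 5), ∃ h ∈ HB, Matrix.GeneralLinearGroup.map resB h = q) →
        ∃ uB : GL (Fin 2) B, Matrix.GeneralLinearGroup.map resB uB = 1 ∧
          ∀ g : GL (Fin 2) (ZMod (5 ^ (k + 1))),
            Matrix.det (g : Matrix (Fin 2) (Fin 2) (ZMod (5 ^ (k + 1)))) ^ 4 = 1 →
              uB * Matrix.GeneralLinearGroup.map (ZMod.castHom (dvd_refl (5 ^ (k + 1))) B) g * uB⁻¹ ∈ HB)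
    (H : Subgroup (GL (Fin 2) A))
    (hHμ : ∀ h ∈ H, Matrix.det (h : Matrix (Fin 2) (Fin 2) A) ^ 4 = 1)
    (hres : ∀ q : GL (Fin 2) (ZMod 5), ∃ h ∈ H, Matrix.GeneralLinearGroup.map res h = q) :
    ∃ u : GL (Fin 2) A, Matrix.GeneralLinearGroup.map res u = 1 ∧
      ∀ g : GL (Fin 2) (ZMod (5 ^ (m + 1))),
        Matrix.det (g : Matrix (Fin 2) (Fin 2) (ZMod (5 ^ (m + 1)))) ^ 4 = 1 →
          u * Matrix.GeneralLinearGroup.map (ZMod.castHom (dvd_refl (5 ^ (m + 1))) A) g * u⁻¹ ∈ H := by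
  classical
  haveI : Fact (1 < 5) := ⟨by norm_num⟩
  set πG := Matrix.GeneralLinearGroup.map (n := Fin 2) π with hπG
  set ρ := Matrix.GeneralLinearGroup.map (n := Fin 2) res with hρ
  set ρB := Matrix.GeneralLinearGroup.map (n := Fin 2) resB with hρB
  set ιA := Matrix.GeneralLinearGroup.map (n := Fin 2) (ZMod.castHom (dvd_refl (5 ^ (m + 1))) A) with hιA
  set ιB := Matrix.GeneralLinearGroup.map (n := Fin 2) (ZMod.castHom (dvd_refl (5 ^ (k + 1))) B) with hιB
  have hρBπ : ∀ h : GL (Fin 2) A, ρB (πG h) = ρ h := by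
    intro h
    have e : Matrix.GeneralLinearGroup.map (n := Fin 2) (resB.comp π) h = ρ h := by rw [hresB]
    rw [Matrix.GeneralLinearGroup.map_comp] at e
    exact e
  -- the image subgroup downstairs
  set HB := H.map πG with hHB
  have hHBμ : ∀ h ∈ HB, Matrix.det (h : Matrix (Fin 2) (Fin 2) B) ^ 4 = 1 := by
    intro h hh
    obtain ⟨h₀, hh₀, rfl⟩ := Subgroup.mem_map.1 hh
    have hd : Matrix.det ((πG h₀).val) = π (Matrix.det h₀.val) := by
      rw [RingHom.map_det]; rfl
    rw [hd, ← map_pow, hHμ h₀ hh₀, map_one]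
  have hresHB : ∀ q : GL (Fin 2) (ZMod 5), ∃ h ∈ HB, ρB h = q := by
    intro q
    obtain ⟨h, hh, hq⟩ := hres q
    exact ⟨πG h, Subgroup.mem_map_of_mem πG hh, by rw [hρBπ, hq]⟩
  obtain ⟨uB, huB1, huB⟩ := ihB HB hHBμ hresHB
  -- lift the conjugator (units lift along `π` because `A` is local)
  have hent : ∀ i j, ∃ a : A, π a = uB.val i j := fun i j => hπ _
  choose M hM using hent
  have hMπ : (Matrix.of fun i j => M i j).map π = uB.val := by
    ext i j; simp only [Matrix.map_apply, Matrix.of_apply, hM]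
  have hdetM : IsUnit (Matrix.det (Matrix.of fun i j => M i j)) := by
    apply hloc
    have h1 : π (Matrix.det (Matrix.of fun i j => M i j)) = Matrix.det uB.val := by
      rw [RingHom.map_det, RingHom.mapMatrix_apply, hMπ]
    have h2 : res (Matrix.det (Matrix.of fun i j => M i j)) = resB (Matrix.det uB.val) := by
      rw [← hresB, RingHom.comp_apply, h1]
    rw [h2]
    have hu : IsUnit (Matrix.det uB.val) := by
      rw [← Matrix.GeneralLinearGroup.val_det_apply]; exact Units.isUnit _
    exact (hu.map resB).ne_zero
  set u₁ : GL (Fin 2) A := Matrix.GeneralLinearGroup.mk'' _ hdetM with hu₁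
  have hu₁π : πG u₁ = uB := by
    apply Units.ext
    show (u₁.val).map π = uB.val
    exact hMπ
  have hu₁res : ρ u₁ = 1 := by rw [← hρBπ, hu₁π, huB1]
  -- the conjugated subgroup `u₁⁻¹ H u₁`
  set H₁ : Subgroup (GL (Fin 2) A) := H.comap (MulAut.conj u₁).toMonoidHom with hH₁
  have hH₁mem : ∀ x, x ∈ H₁ ↔ u₁ * x * u₁⁻¹ ∈ H := fun x => by rw [hH₁, Subgroup.mem_comap]; rfl
  have hH₁μ : ∀ h ∈ H₁, Matrix.det (h : Matrix (Fin 2) (Fin 2) A) ^ 4 = 1 := by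
    intro h hh
    have h1 := hHμ _ ((hH₁mem h).1 hh)
    rwa [Units.val_mul, Units.val_mul, Matrix.det_units_conj] at h1
  have hcover₁ : ∀ q : GL (Fin 2) (ZMod (5 ^ (k + 1))),
      Matrix.det (q : Matrix (Fin 2) (Fin 2) (ZMod (5 ^ (k + 1)))) ^ 4 = 1 →
        ∃ h ∈ H₁, πG h = ιB q := by
    intro q hq
    obtain ⟨h₀, hh₀, hh₀π⟩ := Subgroup.mem_map.1 (huB q hq)
    refine ⟨u₁⁻¹ * h₀ * u₁, (hH₁mem _).2 ?_, ?_⟩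
    · have e : u₁ * (u₁⁻¹ * h₀ * u₁) * u₁⁻¹ = h₀ := by group
      rw [e]; exact hh₀
    · rw [map_mul, map_mul, map_inv, hh₀π, hu₁π]; group
  obtain ⟨u₂, hu₂π, hu₂⟩ := hlayer H₁ hH₁μ hcover₁
  refine ⟨u₁ * u₂, ?_, fun g hg => ?_⟩
  · rw [map_mul, hu₁res, one_mul, ← hρBπ, hu₂π, map_one]
  · have h1 := (hH₁mem _).1 (hu₂ g hg)
    have e : u₁ * u₂ * ιA g * (u₁ * u₂)⁻¹ = u₁ * (u₂ * ιA g * u₂⁻¹) * u₁⁻¹ := by group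
    rw [e]; exact h1

end localstep

section localring

universe u

/-- **(T5′) at every finite level for residue field `𝔽₅`, `S^μ` currency (ARM-P r07 S7 ADD-1 §C (C0); the
Artinian kernel (P′) assembled).** Let `A` be a FINITE commutative ring with a ring map `res : A → 𝔽₅` such
that every element of non-zero residue is a unit (a finite local ring with residue field `𝔽₅`), of
characteristic `5^{m+1}`. Let `H ≤ GL₂(A)` be a subgroup with `(det h)⁴ = 1` on `H` whose reduction covers
`GL₂(𝔽₅)`. Then `u · S^μ(ℤ/5^{m+1}) · u⁻¹ ⊆ H` for some `u ∈ GL₂(A)` with `res(u) = 1` — so `H` contains a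
conjugate of `SL₂(ℤ/5^{m+1})`, the image of `SL₂(W(𝔽₅))`. Induction on `|A|` through files IX (same
characteristic) and X (characteristic drop), via `exists_conj_smu_le_of_step`. -/
theorem exists_conj_smu_le_of_residual (A : Type u) [CommRing A] [Finite A]
    (res : A →+* ZMod 5) (hloc : ∀ a, res a ≠ 0 → IsUnit a) (m : ℕ) [CharP A (5 ^ (m + 1))]
    (H : Subgroup (GL (Fin 2) A))
    (hHμ : ∀ h ∈ H, Matrix.det (h : Matrix (Fin 2) (Fin 2) A) ^ 4 = 1)
    (hres : ∀ q : GL (Fin 2) (ZMod 5), ∃ h ∈ H, Matrix.GeneralLinearGroup.map res h = q) :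
    ∃ u : GL (Fin 2) A, Matrix.GeneralLinearGroup.map res u = 1 ∧
      ∀ g : GL (Fin 2) (ZMod (5 ^ (m + 1))),
        Matrix.det (g : Matrix (Fin 2) (Fin 2) (ZMod (5 ^ (m + 1)))) ^ 4 = 1 →
          u * Matrix.GeneralLinearGroup.map (ZMod.castHom (dvd_refl (5 ^ (m + 1))) A) g * u⁻¹ ∈ H := by
  classical
  -- strong induction on `|A|`, for all residue maps, levels and subgroups at once
  suffices key : ∀ (n : ℕ) (A : Type u) [CommRing A] [Finite A], Nat.card A = n →
      ∀ (res : A →+* ZMod 5), (∀ a, res a ≠ 0 → IsUnit a) → ∀ (m : ℕ) [CharP A (5 ^ (m + 1))]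
        (H : Subgroup (GL (Fin 2) A)), (∀ h ∈ H, Matrix.det (h : Matrix (Fin 2) (Fin 2) A) ^ 4 = 1) →
        (∀ q : GL (Fin 2) (ZMod 5), ∃ h ∈ H, Matrix.GeneralLinearGroup.map res h = q) →
          ∃ u : GL (Fin 2) A, Matrix.GeneralLinearGroup.map res u = 1 ∧
            ∀ g : GL (Fin 2) (ZMod (5 ^ (m + 1))),
              Matrix.det (g : Matrix (Fin 2) (Fin 2) (ZMod (5 ^ (m + 1)))) ^ 4 = 1 →
                u * Matrix.GeneralLinearGroup.map (ZMod.castHom (dvd_refl (5 ^ (m + 1))) A) g * u⁻¹ ∈ H from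
    key _ A rfl res hloc m H hHμ hres
  intro n
  induction n using Nat.strong_induction_on with
  | _ n ih => ?_
  intro A _ _ hn res hloc m _ H hHμ hres
  have h55 : (5 : ZMod 5) = 0 := by decide
  haveI : Fact (1 < 5) := ⟨by norm_num⟩
  haveI : Fact (Nat.Prime 5) := ⟨by norm_num⟩
  haveI : NeZero (5 ^ (m + 1)) := ⟨pow_ne_zero _ (by norm_num)⟩
  set ρ := Matrix.GeneralLinearGroup.map (n := Fin 2) res with hρ
  set ιA := Matrix.GeneralLinearGroup.map (n := Fin 2) (ZMod.castHom (dvd_refl (5 ^ (m + 1))) A) with hιA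
  -- residues of integers prime to `5` are units; `5^j ≠ 0` for `j ≤ m`
  have hunit_res : ∀ a, IsUnit a → res a ≠ 0 := fun a ha => (ha.map res).ne_zero
  have h5pow : ∀ j, j ≤ m → ((5 : A) ^ j) ≠ 0 := by
    intro j hj h
    have h' : ((5 ^ j : ℕ) : A) = 0 := by exact_mod_cast h
    rw [CharP.cast_eq_zero_iff A (5 ^ (m + 1))] at h'
    have := Nat.pow_dvd_pow_iff_le_right (by norm_num : 1 < 5) |>.1 h'
    omega
  have hres5 : ∀ j, res ((5 : A) ^ (j + 1)) = 0 := by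
    intro j; rw [map_pow, map_ofNat, h55, zero_pow (Nat.succ_ne_zero j)]
  -- CASE 0: `res` injective — then `A = 𝔽₅`, `H` is everything, `u = 1`
  by_cases hinj : ∀ a, res a = 0 → a = 0
  · refine ⟨1, map_one _, fun g _ => ?_⟩
    rw [one_mul, inv_one, mul_one]
    obtain ⟨h, hh, hq⟩ := hres (ρ (ιA g))
    have he : h = ιA g := by
      apply Units.ext; ext i j
      have e := congrArg (fun x : GL (Fin 2) (ZMod 5) => x.val i j) hq
      simp only [hρ, Matrix.GeneralLinearGroup.map_apply] at e
      have e2 : res (h.val i j - (ιA g).val i j) = 0 := by rw [map_sub, sub_eq_zero]; exact e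
      exact sub_eq_zero.1 (hinj _ e2)
    rw [← he]; exact hh
  obtain ⟨a₀, ha₀'⟩ := not_forall.1 hinj
  obtain ⟨ha₀res, ha₀⟩ := Classical.not_imp.1 ha₀'
  -- `A` is local with maximal ideal `ker res`, which is nilpotent
  haveI : Nontrivial A := ⟨⟨0, 1, fun h => by
    have e := congrArg res h; rw [map_zero, map_one] at e; exact zero_ne_one e⟩⟩
  haveI : IsLocalRing A := by
    refine IsLocalRing.of_isUnit_or_isUnit_one_sub_self fun a => ?_
    by_cases h : res a = 0
    · right; apply hloc; rw [map_sub, map_one, h, sub_zero]; exact one_ne_zero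
    · left; exact hloc a h
  have hmax : ∀ a, a ∈ IsLocalRing.maximalIdeal A ↔ res a = 0 := by
    intro a
    rw [IsLocalRing.mem_maximalIdeal, mem_nonunits_iff]
    constructor
    · intro h; by_contra h'; exact h (hloc a h')
    · intro h hu; exact hunit_res a hu h
  obtain ⟨N, hN⟩ : ∃ N : ℕ, IsLocalRing.maximalIdeal A ^ N = ⊥ := by
    obtain ⟨N, hN⟩ := IsArtinianRing.isNilpotent_jacobson_bot (R := A)
    rw [IsLocalRing.jacobson_eq_maximalIdeal ⊥ bot_ne_top] at hN
    exact ⟨N, hN⟩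
  -- the common tail of both cases: a principal small element `t` and the induction step
  have htail : ∀ (t : A) (k : ℕ), t ≠ 0 → res t = 0 → (∀ a, t * a = 0 ↔ res a = 0) →
      (∀ x : ℕ, (∃ y, (x : A) = t * y) ↔ 5 ^ (k + 1) ∣ x) → (k = m ∨ (k + 1 = m ∧ t = (5 : A) ^ m)) →
      ∃ u : GL (Fin 2) A, ρ u = 1 ∧
        ∀ g : GL (Fin 2) (ZMod (5 ^ (m + 1))),
          Matrix.det (g : Matrix (Fin 2) (Fin 2) (ZMod (5 ^ (m + 1)))) ^ 4 = 1 → u * ιA g * u⁻¹ ∈ H := by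
    intro t k ht0 htres hann hchar hk
    -- the quotient `B = A/tA`
    let I : Ideal A := Ideal.span {t}
    let π : A →+* A ⧸ I := Ideal.Quotient.mk I
    have hπ : Function.Surjective π := Ideal.Quotient.mk_surjective
    have hker : ∀ a, π a = 0 ↔ ∃ x, a = t * x := by
      intro a
      rw [Ideal.Quotient.eq_zero_iff_mem, Ideal.mem_span_singleton']
      constructor
      · rintro ⟨x, hx⟩; exact ⟨x, by rw [← hx, mul_comm]⟩
      · rintro ⟨x, hx⟩; exact ⟨x, by rw [hx, mul_comm]⟩
    haveI : CharP (A ⧸ I) (5 ^ (k + 1)) := ⟨fun x => by rw [← map_natCast π, hker]; exact hchar x⟩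
    haveI : Finite (A ⧸ I) := Finite.of_surjective π hπ
    have hIres : ∀ a ∈ I, res a = 0 := by
      intro a ha
      obtain ⟨x, hx⟩ := (hker a).1 (Ideal.Quotient.eq_zero_iff_mem.2 ha)
      rw [hx, map_mul, htres, zero_mul]
    let resB : A ⧸ I →+* ZMod 5 := Ideal.Quotient.lift I res hIres
    have hresB : resB.comp π = res := RingHom.ext fun a => Ideal.Quotient.lift_mk I res hIres
    have hlocB : ∀ b, resB b ≠ 0 → IsUnit b := by
      intro b hb
      obtain ⟨a, rfl⟩ := hπ b
      have h : res a ≠ 0 := by rwa [← hresB]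
      exact (hloc a h).map π
    have hlt : Nat.card (A ⧸ I) < n := by
      rw [← hn]
      haveI := Fintype.ofFinite A
      haveI := Fintype.ofFinite (A ⧸ I)
      rw [Nat.card_eq_fintype_card, Nat.card_eq_fintype_card]
      refine Fintype.card_lt_of_surjective_not_injective π hπ fun hi => ht0 (hi ?_)
      rw [map_zero, (hker t).2 ⟨1, (mul_one t).symm⟩]
    refine exists_conj_smu_le_of_step m k π hπ res resB hresB hloc ?_
      (fun HB h1 h2 => ih _ hlt (A ⧸ I) rfl resB hlocB k HB h1 h2) H hHμ hres
    -- the layer statement for `π`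
    intro H₁ hH₁μ hcov
    rcases hk with rfl | ⟨hkm, rfl⟩
    · exact exists_conj_smu_le_of_smallLayer k π res t htres hann hker H₁ hH₁μ hcov
    · subst hkm
      refine ⟨1, map_one _, fun g hg => ?_⟩
      rw [one_mul, inv_one, mul_one]
      exact smu_map_mem_of_smallDrop (k + 1) (by omega) π res hann hker H₁ hH₁μ hcov g hg
  -- CASE 1 (characteristic drop): `m ≥ 1` and `5^m` kills `ker res` — take `t = 5^m`
  by_cases hdrop : 1 ≤ m ∧ ∀ a, res a = 0 → (5 : A) ^ m * a = 0
  · obtain ⟨hm1, hdrop⟩ := hdrop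
    obtain ⟨k, rfl⟩ : ∃ k, m = k + 1 := ⟨m - 1, by omega⟩
    have hann : ∀ a, (5 : A) ^ (k + 1) * a = 0 ↔ res a = 0 := by
      intro a
      refine ⟨fun h => ?_, hdrop a⟩
      by_contra hne
      obtain ⟨v, hv⟩ := hloc a hne
      apply h5pow (k + 1) le_rfl
      calc (5 : A) ^ (k + 1) = (5 : A) ^ (k + 1) * a * ↑v⁻¹ := by rw [← hv, Units.mul_inv_cancel_right]
        _ = 0 := by rw [h, zero_mul]
    refine htail ((5 : A) ^ (k + 1)) k (h5pow _ le_rfl) (hres5 k) hann (fun x => ?_) (Or.inr ⟨rfl, rfl⟩)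
    constructor
    · rintro ⟨y, hy⟩
      rcases Nat.eq_zero_or_pos x with hx | hx
      · rw [hx]; exact dvd_zero _
      obtain ⟨j, x', hx', rfl⟩ := Nat.exists_eq_pow_mul_and_not_dvd hx.ne' 5 (by norm_num)
      by_cases hjk : k + 1 ≤ j
      · exact Dvd.dvd.mul_right (pow_dvd_pow 5 hjk) x'
      · exfalso
        have hx'u : IsUnit ((x' : ℕ) : A) := by
          apply hloc; rw [map_natCast, Ne, CharP.cast_eq_zero_iff (ZMod 5) 5]; exact hx'
        have hw : res ((x' : ℕ) - (5 : A) ^ (k + 1 - j) * y : A) ≠ 0 := by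
          obtain ⟨d, hd⟩ : ∃ d, k + 1 - j = d + 1 := ⟨k - j, by omega⟩
          rw [map_sub, map_mul, hd, hres5 d, zero_mul, sub_zero]; exact hunit_res _ hx'u
        obtain ⟨w, hw'⟩ := hloc _ hw
        apply h5pow j (by omega)
        have e : (5 : A) ^ j * (((x' : ℕ) : A) - (5 : A) ^ (k + 1 - j) * y) = 0 := by
          rw [mul_sub, ← mul_assoc, ← pow_add, show j + (k + 1 - j) = k + 1 by omega, ← hy]
          push_cast; ring
        calc (5 : A) ^ j = (5 : A) ^ j * (((x' : ℕ) : A) - (5 : A) ^ (k + 1 - j) * y) * ↑w⁻¹ := by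
              rw [← hw', Units.mul_inv_cancel_right]
          _ = 0 := by rw [e, zero_mul]
    · rintro ⟨c, rfl⟩; exact ⟨(c : A), by push_cast; ring⟩
  -- CASE 2 (same characteristic): `t ∈ 𝔪^{N₀-1} ∖ 0` with `𝔪^{N₀} = 0`
  · let P : ℕ → Prop := fun N => IsLocalRing.maximalIdeal A ^ N = ⊥
    have hP : ∃ N, P N := ⟨N, hN⟩
    let N₀ := Nat.find hP
    have hN₀ : IsLocalRing.maximalIdeal A ^ N₀ = ⊥ := Nat.find_spec hP
    have hN₀2 : 2 ≤ N₀ := by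
      by_contra hlt
      have h01 : N₀ = 0 ∨ N₀ = 1 := by omega
      rcases h01 with h0 | h1
      · have : (1 : A) ∈ (⊥ : Ideal A) := by rw [← hN₀, h0, pow_zero, Ideal.one_eq_top]; exact Submodule.mem_top
        exact one_ne_zero ((Submodule.mem_bot A).1 this)
      · have : a₀ ∈ (⊥ : Ideal A) := by rw [← hN₀, h1, pow_one]; exact (hmax a₀).2 ha₀res
        exact ha₀ ((Submodule.mem_bot A).1 this)
    have hne : IsLocalRing.maximalIdeal A ^ (N₀ - 1) ≠ ⊥ := Nat.find_min hP (by omega)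
    obtain ⟨t, htmem, ht0⟩ := (Submodule.ne_bot_iff _).1 hne
    have htm : t ∈ IsLocalRing.maximalIdeal A := Ideal.pow_le_self (by omega) htmem
    have htres : res t = 0 := (hmax t).1 htm
    have htkill : ∀ a, res a = 0 → t * a = 0 := by
      intro a ha
      have h : t * a ∈ IsLocalRing.maximalIdeal A ^ (N₀ - 1) * IsLocalRing.maximalIdeal A :=
        Ideal.mul_mem_mul htmem ((hmax a).2 ha)
      rw [← pow_succ, show N₀ - 1 + 1 = N₀ by omega, hN₀] at h
      exact (Submodule.mem_bot A).1 h
    have hann : ∀ a, t * a = 0 ↔ res a = 0 := by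
      intro a
      refine ⟨fun h => ?_, htkill a⟩
      by_contra hne'
      obtain ⟨v, hv⟩ := hloc a hne'
      apply ht0
      calc t = t * a * ↑v⁻¹ := by rw [← hv, Units.mul_inv_cancel_right]
        _ = 0 := by rw [h, zero_mul]
    refine htail t m ht0 htres hann (fun x => ?_) (Or.inl rfl)
    constructor
    · rintro ⟨y, hy⟩
      by_cases hy0 : res y = 0
      · rw [htkill y hy0] at hy
        exact (CharP.cast_eq_zero_iff A (5 ^ (m + 1)) x).1 hy
      · exfalso
        obtain ⟨v, hv⟩ := hloc y hy0
        have htx : t = (x : A) * ↑v⁻¹ := by rw [hy, ← hv, Units.mul_inv_cancel_right]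
        rcases Nat.eq_zero_or_pos x with hx | hx
        · apply ht0; rw [htx, hx, Nat.cast_zero, zero_mul]
        obtain ⟨j, x', hx', rfl⟩ := Nat.exists_eq_pow_mul_and_not_dvd hx.ne' 5 (by norm_num)
        have hx'u : IsUnit ((x' : ℕ) : A) := by
          apply hloc; rw [map_natCast, Ne, CharP.cast_eq_zero_iff (ZMod 5) 5]; exact hx'
        obtain ⟨w, hw⟩ := hx'u
        by_cases hjm : m + 1 ≤ j
        · apply ht0
          rw [htx]; push_cast
          rw [show ((5 : A)) ^ j = 0 from by
            have : ((5 ^ j : ℕ) : A) = 0 := (CharP.cast_eq_zero_iff A (5 ^ (m + 1)) _).2 (pow_dvd_pow 5 hjm)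
            exact_mod_cast this, zero_mul, zero_mul]
        · -- `t = 5^j · unit` with `j ≤ m`: then `5^m` kills `ker res`, and `m ≥ 1` or `t` is a unit
          have ht' : t = (5 : A) ^ j * ↑w * ↑v⁻¹ := by rw [htx]; push_cast; rw [← hw]
          apply hdrop
          refine ⟨?_, fun a ha => ?_⟩
          · by_contra hm0
            have hj0 : j = 0 := by omega
            have htu : IsUnit t := by
              rw [ht', hj0, pow_zero, one_mul]; exact (Units.isUnit w).mul (Units.isUnit v⁻¹)
            exact hunit_res t htu htres
          · have e5j : (5 : A) ^ j * a = ↑w⁻¹ * ↑v * (t * a) := by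
              rw [ht']
              calc (5 : A) ^ j * a = (5 : A) ^ j * ((↑w * ↑w⁻¹) * (↑v⁻¹ * ↑v)) * a := by
                    rw [Units.mul_inv, Units.inv_mul, mul_one, mul_one]
                _ = ↑w⁻¹ * ↑v * ((5 : A) ^ j * ↑w * ↑v⁻¹ * a) := by ring
            rw [show (5 : A) ^ m = (5 : A) ^ (m - j) * (5 : A) ^ j by rw [← pow_add]; congr 1; omega,
              mul_assoc, e5j, htkill a ha, mul_zero, mul_zero]
    · rintro ⟨c, rfl⟩
      exact ⟨0, by rw [mul_zero]; exact (CharP.cast_eq_zero_iff A (5 ^ (m + 1)) _).2 (Dvd.intro c rfl)⟩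

end localring

end Summit.BirchSwinnertonDyer.BirchSwinnertonDyer.Theorems.GL2F5AdjointBricks
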